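import Summits.SmoothPoincare4.SmoothPoincare4.Theorems.EntropyRungConicalGapLocalisation
import Summits.SmoothPoincare4.SmoothPoincare4.Theorems.EntropyRungConicalGapSublevelLayerCake
import Summits.SmoothPoincare4.SmoothPoincare4.Theorems.EntropyRungConicalGapSublevelGrowthMonotone
import Summits.SmoothPoincare4.SmoothPoincare4.Theorems.EntropyRungConicalGapMonotoneTauberian
import Summits.SmoothPoincare4.SmoothPoincare4.Theorems.EntropyRungConicalGapAvrSublevelLimit
import HarnessLib

/-!
# The volume profile of a complete 4-d shrinker: exact ODE, explicit growth, existence of the AVR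
(crux `EntropyRung.ConicalGap`, stmt-SmoothPoincare4-16589; line `Sketch`, lead cycle 5)

Let `(M, g, f)` be a complete connected normalised 4-d gradient shrinking Ricci soliton and put
`V(t) = Vol{f < t}` (the VOLUME PROFILE of the potential; finite, non-decreasing, `= 0` for
`t ≤ 0`) and `A(t) = ∫₀ᵗ V(s) ds = ∫_{f<t} (t − f) dV` (layer cake, `helper_sublevelLayerCake`).
The sublevel identity `∫_{f<t} (2t − 3f + (1 + f − t)R) dV = 0` (`helper_sublevelIdentity`) is
the exact, derivative-free ODE

  `t V(t) − 3 A(t) = ∫_{f<t} (1 + f − t) R dV`            (`helper_volumeProfileIdentity`)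

whose right side is `≤ ∫_{f<t} R dV ≤ 2 V(t)` (`R ≥ 0`; flux inequality
`helper_sublevelFlux_nonneg`). Hence the integral inequality

  `(t − 2) V(t) ≤ 3 A(t)`  for every `t`                   (`helper_volumeProfile_ineq`),

i.e. `A(t)/(t − 2)³` is NON-INCREASING on `(2, ∞)` (`helper_sublevelGrowthMonotone`). Consequences
proved here, all unconditional and new in the tree:

* `helper_volumeGrowth_explicit` — the Cao–Zhou volume growth theorem with EXPLICIT constants:
  `Vol{f<t} ≤ 3 (∫₀ˢ Vol{f<u} du) (t − 2)²/(s − 2)³` for `2 < s ≤ t`, e.g.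
  `Vol{f<t} ≤ 9 · Vol{f<3} · (t − 2)²` for `t ≥ 3` (Euclidean growth `∼ r⁴`, `t ∼ r²/4`);
* `helper_sublevelAvr_exists` — the ASYMPTOTIC VOLUME RATIO `lim_{t→∞} Vol{f<t}/(8π²t²)` EXISTS on
  every complete connected normalised 4-d shrinker (monotone limit of `A/(t−2)³` + the monotone
  Tauberian step `helper_monotoneTauberian`), and is fenced at every finite level by the core
  profile: `8π² · AVR · (t − 2)³ ≤ 3 ∫₀ᵗ Vol{f<s} ds` for all `t > 2`;
* `helper_avr_eq_sublevelAvr` — Wang–Wang's REGULARISED ratio `a = lim (16π²T²)⁻¹ ∫ e^{-f/T} dV`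
  (the `a` of the line's transform `∫ e^{-f} = 16π² a + ∫ R k(f)`, `stub_transformLimit`) IS this
  sublevel AVR (by `helper_avr_eq_sublevelLimit`, p128510, whose existence proviso is now
  discharged), so the line's `a` is the classical asymptotic volume ratio on EVERY complete 4-d
  shrinker — no conical-structure theorem is needed — and obeys the finite-level fence.

Everything here is proved; no definition and no named fact is introduced.

## References

* H.-D. Cao, D. Zhou, *On complete gradient shrinking Ricci solitons*, JDG 85 (2010), Thm. 1.2
  and §3 (volume growth `Vol B_r ≤ C rⁿ` by integrating `Δf = n/2 − R` over sublevel sets).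
* Y. Wang, G. Wang (Wang–Wang 2023), arXiv:2308.06560, (2.6) and Prop. 2.6.
* R. Haslhofer, R. Müller, GAFA 21 (2011), Lemma 2.2.
-/

noncomputable section

-- `Summit.SmoothPoincare4.SmoothPoincare4.…` (summit = problem) trips `dupNamespace` on every decl.
set_option linter.dupNamespace false

open scoped Manifold ContDiff ENNReal NNReal Topology
open MeasureTheory Set Filter
open Literature.Geometry.Lorentzian Literature.Geometry.Riemannian

namespace Summit.SmoothPoincare4.SmoothPoincare4.Theorems.ConicalGapSketch

open CarrilloNi2009_shrinkerLSI

/-! ## The abstract volume profile: a measure finite on compacts, a proper continuous `f ≥ 0`,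
a continuous `R ≥ 0`, the sublevel identity and the flux inequality -/

section Profile

variable {X : Type} [TopologicalSpace X] [MeasurableSpace X] [OpensMeasurableSpace X]
  {μ : Measure X} [IsFiniteMeasureOnCompacts μ] {f R : X → ℝ}

omit [OpensMeasurableSpace X] in
/-- Strict sublevel sets of a proper function have finite measure. -/
theorem profile_measure_lt_top (hprop : ∀ t : ℝ, IsCompact {x | f x ≤ t}) (t : ℝ) :
    μ {x | f x < t} < ⊤ :=
  lt_of_le_of_lt (measure_mono fun x (hx : f x < t) ↦ show f x ≤ t from hx.le)
    (hprop t).measure_lt_top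

/-- A continuous function is integrable on the strict sublevel sets of a proper continuous
function. -/
theorem profile_integrableOn (hf : Continuous f) (hprop : ∀ t : ℝ, IsCompact {x | f x ≤ t})
    {φ : X → ℝ} (hφ : Continuous φ) (t : ℝ) : IntegrableOn φ {x | f x < t} μ :=
  (hφ.continuousOn.integrableOn_compact' (hprop t)
    (isClosed_le hf continuous_const).measurableSet).mono_set fun x hx ↦ show f x ≤ t from le_of_lt hx

omit [OpensMeasurableSpace X] in
/-- The volume profile `t ↦ (μ {f < t}).toReal` of a proper function is non-decreasing. -/
theorem profile_monotone (hprop : ∀ t : ℝ, IsCompact {x | f x ≤ t}) :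
    Monotone fun t ↦ (μ {x | f x < t}).toReal := fun s t hst ↦
  ENNReal.toReal_mono (profile_measure_lt_top hprop t).ne
    (measure_mono fun x (hx : f x < s) ↦ hx.trans_le hst)

omit [TopologicalSpace X] [OpensMeasurableSpace X] [IsFiniteMeasureOnCompacts μ] in
/-- The volume profile of a non-negative function vanishes at non-positive levels. -/
theorem profile_eq_zero_of_nonpos (hf0 : ∀ x, 0 ≤ f x) {s : ℝ} (hs : s ≤ 0) :
    (μ {x | f x < s}).toReal = 0 := by
  have h : {x | f x < s} = ∅ := eq_empty_of_forall_notMem fun x hx ↦ by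
    have hx' : f x < s := hx
    linarith [hf0 x]
  rw [h, measure_empty, ENNReal.toReal_zero]

/-- **The volume-profile identity (abstract form).** If `∫_{f<t} (2t − 3f + (1 + f − t)R) dμ = 0`
then `t V(t) − 3 ∫₀ᵗ V = ∫_{f<t} (1 + f − t) R dμ` for `t ≥ 0`, `V(s) = μ{f < s}`
(split the integral and use the layer cake `∫_{f<t} (t − f) = ∫₀ᵗ V`). -/
theorem profile_identity (hf : Continuous f) (hR : Continuous R) (hf0 : ∀ x, 0 ≤ f x)
    (hprop : ∀ t : ℝ, IsCompact {x | f x ≤ t})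
    (hId : ∀ t : ℝ, ∫ x in {x | f x < t}, (2 * t - 3 * f x + (1 + f x - t) * R x) ∂μ = 0)
    {t : ℝ} (ht : 0 ≤ t) :
    t * (μ {x | f x < t}).toReal - 3 * ∫ s in (0 : ℝ)..t, (μ {x | f x < s}).toReal =
      ∫ x in {x | f x < t}, (1 + f x - t) * R x ∂μ := by
  have hLC := (helper_sublevelLayerCake X μ f hf.measurable hf0 (profile_measure_lt_top hprop)
    t ht).2
  have i1 : IntegrableOn (fun x ↦ t - f x) {x | f x < t} μ :=
    profile_integrableOn hf hprop (continuous_const.sub hf) t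
  have i2 : IntegrableOn (fun x ↦ (1 + f x - t) * R x) {x | f x < t} μ :=
    profile_integrableOn hf hprop (((continuous_const.add hf).sub continuous_const).mul hR) t
  have i3 : IntegrableOn (fun _ ↦ t) {x | f x < t} μ :=
    profile_integrableOn hf hprop continuous_const t
  have i13 : IntegrableOn (fun x ↦ 3 * (t - f x) - t) {x | f x < t} μ := (i1.const_mul 3).sub i3
  have hsplit : ∫ x in {x | f x < t}, (2 * t - 3 * f x + (1 + f x - t) * R x) ∂μ =
      3 * (∫ x in {x | f x < t}, (t - f x) ∂μ) - (∫ x in {x | f x < t}, t ∂μ) +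
        ∫ x in {x | f x < t}, (1 + f x - t) * R x ∂μ := by
    have h1 : ∫ x in {x | f x < t}, (2 * t - 3 * f x + (1 + f x - t) * R x) ∂μ =
        ∫ x in {x | f x < t}, (3 * (t - f x) - t + (1 + f x - t) * R x) ∂μ :=
      integral_congr_ae (Eventually.of_forall fun x ↦ by ring)
    have h2 : ∫ x in {x | f x < t}, (3 * (t - f x) - t + (1 + f x - t) * R x) ∂μ =
        (∫ x in {x | f x < t}, (3 * (t - f x) - t) ∂μ) +
          ∫ x in {x | f x < t}, (1 + f x - t) * R x ∂μ := integral_add i13 i2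
    have h3 : ∫ x in {x | f x < t}, (3 * (t - f x) - t) ∂μ =
        3 * (∫ x in {x | f x < t}, (t - f x) ∂μ) - ∫ x in {x | f x < t}, t ∂μ := by
      rw [integral_sub (i1.const_mul 3) i3, integral_const_mul]
    rw [h1, h2, h3]
  have hconst : ∫ x in {x | f x < t}, t ∂μ = t * (μ {x | f x < t}).toReal := by
    rw [setIntegral_const, smul_eq_mul, measureReal_def, mul_comm]
  rw [hId t, hLC, hconst] at hsplit
  linarith

/-- **The integral inequality for the profile (abstract form).** Under the sublevel identity and
the flux inequality `0 ≤ ∫_{f<t} (2 − R)`, with `R ≥ 0`: `(t − 2) V(t) ≤ 3 ∫₀ᵗ V` for every `t`. -/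
theorem profile_ineq (hf : Continuous f) (hR : Continuous R) (hf0 : ∀ x, 0 ≤ f x)
    (hR0 : ∀ x, 0 ≤ R x) (hprop : ∀ t : ℝ, IsCompact {x | f x ≤ t})
    (hId : ∀ t : ℝ, ∫ x in {x | f x < t}, (2 * t - 3 * f x + (1 + f x - t) * R x) ∂μ = 0)
    (hFlux : ∀ t : ℝ, 0 ≤ ∫ x in {x | f x < t}, (2 - R x) ∂μ) (t : ℝ) :
    (t - 2) * (μ {x | f x < t}).toReal ≤ 3 * ∫ s in (0 : ℝ)..t, (μ {x | f x < s}).toReal := by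
  have hVnn : 0 ≤ (μ {x | f x < t}).toReal := ENNReal.toReal_nonneg
  -- the primitive is non-negative at every level
  have hA0 : 0 ≤ ∫ s in (0 : ℝ)..t, (μ {x | f x < s}).toReal := by
    rcases le_or_gt 0 t with ht | ht
    · exact intervalIntegral.integral_nonneg ht fun s _ ↦ ENNReal.toReal_nonneg
    · rw [intervalIntegral.integral_symm, neg_nonneg]
      refine le_of_eq (intervalIntegral.integral_zero_ae (Eventually.of_forall fun s hs ↦ ?_))
      rw [uIoc_of_le ht.le] at hs
      exact profile_eq_zero_of_nonpos hf0 hs.2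
  rcases le_or_gt t 2 with ht2 | ht2
  · exact (mul_nonpos_of_nonpos_of_nonneg (by linarith) hVnn).trans (by linarith)
  -- `t > 2`: the identity, `(1 + f − t) R ≤ R` on `{f < t}`, and the flux inequality
  have ht0 : (0 : ℝ) ≤ t := by linarith
  have hid := profile_identity hf hR hf0 hprop hId ht0
  have hS : MeasurableSet {x | f x < t} := measurableSet_lt hf.measurable measurable_const
  have iR : IntegrableOn R {x | f x < t} μ := profile_integrableOn hf hprop hR t
  have iB : IntegrableOn (fun x ↦ (1 + f x - t) * R x) {x | f x < t} μ :=
    profile_integrableOn hf hprop (((continuous_const.add hf).sub continuous_const).mul hR) t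
  have i2 : IntegrableOn (fun _ ↦ (2 : ℝ)) {x | f x < t} μ :=
    profile_integrableOn hf hprop continuous_const t
  have hBχ : ∫ x in {x | f x < t}, (1 + f x - t) * R x ∂μ ≤ ∫ x in {x | f x < t}, R x ∂μ := by
    refine setIntegral_mono_on iB iR hS fun x hx ↦ ?_
    have hx' : f x < t := hx
    nlinarith [hR0 x]
  have hχV : ∫ x in {x | f x < t}, R x ∂μ ≤ 2 * (μ {x | f x < t}).toReal := by
    have h := hFlux t
    rw [integral_sub i2 iR, setIntegral_const, smul_eq_mul, measureReal_def] at h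
    linarith
  linarith

/-- **Existence of the asymptotic volume ratio (abstract form).** For a monotone `V ≥ 0` with
`(t − 2) V(t) ≤ 3 ∫₀ᵗ V` for all `t`: there is `φ ≥ 0` with `∫₀ᵗ V / (t − 2)³ → φ`,
`V(t)/t² → 3φ`, and `φ (t − 2)³ ≤ ∫₀ᵗ V` for every `t > 2` (monotone convergence of the
non-increasing quotient, `helper_sublevelGrowthMonotone`, and the Tauberian step
`helper_monotoneTauberian`). -/
theorem profile_avr_exists {V : ℝ → ℝ} (hV : Monotone V) (hV0 : ∀ t, 0 ≤ V t)
    (hineq : ∀ t : ℝ, (t - 2) * V t ≤ 3 * ∫ s in (0 : ℝ)..t, V s) :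
    ∃ φ : ℝ, 0 ≤ φ ∧ Tendsto (fun t ↦ V t / t ^ 2) atTop (𝓝 (3 * φ)) ∧
      ∀ t : ℝ, 2 < t → φ * (t - 2) ^ 3 ≤ ∫ s in (0 : ℝ)..t, V s := by
  obtain ⟨hanti, -⟩ := helper_sublevelGrowthMonotone V hV hV0 hineq
  set Φ : ℝ → ℝ := fun t ↦ (∫ s in (0 : ℝ)..t, V s) / (t - 2) ^ 3 with hΦ
  have hA0 : ∀ t, 0 ≤ t → 0 ≤ ∫ s in (0 : ℝ)..t, V s := fun t ht ↦
    intervalIntegral.integral_nonneg ht fun s _ ↦ hV0 s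
  have hΦ0 : ∀ t, 2 < t → 0 ≤ Φ t := fun t ht ↦
    div_nonneg (hA0 t (by linarith)) (pow_nonneg (by linarith) 3)
  -- a globally antitone modification `Ψ t = Φ (max t 3)`
  set Ψ : ℝ → ℝ := fun t ↦ Φ (max t 3) with hΨ
  have h23 : ∀ s : ℝ, (2 : ℝ) < max s 3 := fun s ↦ lt_max_of_lt_right (by norm_num)
  have hΨanti : Antitone Ψ := fun s t hst ↦
    hanti (show (2 : ℝ) < max s 3 from h23 s) (show (2 : ℝ) < max t 3 from h23 t)
      (max_le_max hst le_rfl)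
  have hΨbdd : BddBelow (range Ψ) := ⟨0, by
    rintro _ ⟨t, rfl⟩
    exact hΦ0 _ (h23 t)⟩
  have hΨlim : Tendsto Ψ atTop (𝓝 (⨅ t, Ψ t)) := tendsto_atTop_ciInf hΨanti hΨbdd
  set φ : ℝ := ⨅ t, Ψ t with hφ
  have hφ0 : 0 ≤ φ := le_ciInf fun t ↦ hΦ0 _ (h23 t)
  have hφle : ∀ t, 2 < t → φ ≤ Φ t := fun t ht ↦
    (ciInf_le hΨbdd t).trans (hanti (show (2 : ℝ) < t from ht) (show (2 : ℝ) < max t 3 from h23 t)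
      (le_max_left t 3))
  -- `Φ → φ`, hence `A/t³ → φ`
  have hΦlim : Tendsto Φ atTop (𝓝 φ) := by
    refine hΨlim.congr' ?_
    filter_upwards [eventually_ge_atTop (3 : ℝ)] with t ht
    simp only [hΨ, max_eq_left ht]
  have hratio : Tendsto (fun t : ℝ ↦ ((t - 2) / t) ^ 3) atTop (𝓝 1) := by
    have h0 : Tendsto (fun t : ℝ ↦ 2 * t⁻¹) atTop (𝓝 (2 * 0)) :=
      tendsto_inv_atTop_zero.const_mul 2
    have h1 : Tendsto (fun t : ℝ ↦ 1 - 2 * t⁻¹) atTop (𝓝 (1 - 2 * 0)) := tendsto_const_nhds.sub h0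
    rw [mul_zero, sub_zero] at h1
    have h2 := h1.pow 3
    rw [one_pow] at h2
    refine h2.congr' ?_
    filter_upwards [eventually_gt_atTop (0 : ℝ)] with t ht
    have ht0 : t ≠ 0 := ht.ne'
    field_simp
  have hAlim : Tendsto (fun t ↦ (∫ s in (0 : ℝ)..t, V s) / t ^ 3) atTop (𝓝 φ) := by
    have h := hΦlim.mul hratio
    rw [mul_one] at h
    refine h.congr' ?_
    filter_upwards [eventually_gt_atTop (2 : ℝ)] with t ht
    have ht0 : t ≠ 0 := by positivity
    have ht2 : t - 2 ≠ 0 := sub_ne_zero.2 (by linarith)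
    simp only [hΦ]
    field_simp
  refine ⟨φ, hφ0, helper_monotoneTauberian V φ hV hAlim, fun t ht ↦ ?_⟩
  have h := hφle t ht
  simp only [hΦ] at h
  rwa [le_div_iff₀ (pow_pos (by linarith) 3)] at h

end Profile

/-! ## The registered 4-d helpers -/

/-- **The volume-profile identity** (registered helper `helper_volumeProfileIdentity` of line
`Sketch`): on every complete connected normalised 4-d gradient shrinking Ricci soliton, for
`t ≥ 0`, `t · Vol{f<t} − 3 ∫₀ᵗ Vol{f<s} ds = ∫_{f<t} (1 + f − t) R dV` — the exact,
derivative-free ODE of the volume profile (`helper_sublevelIdentity` + layer cake). -/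
theorem helper_volumeProfileIdentity : ∀ (M : Type) [TopologicalSpace M] [T2Space M] [SecondCountableTopology M] [ChartedSpace (EuclideanSpace ℝ (Fin 4)) M] [IsManifold (𝓡 4) ∞ M] [ConnectedSpace M] [T3Space M] [MeasurableSpace M] [BorelSpace M] (g : Literature.Geometry.Lorentzian.PseudoRiemannianMetric (𝓡 4) ∞ (EuclideanSpace ℝ (Fin 4)) (TangentSpace (𝓡 4) : M → Type _)) [g.HasLeviCivita] (f : M → ℝ) (hg : g.IsRiemannian), (∀ (x : M) (r : NNReal), IsCompact {y : M | g.edist hg x y ≤ r}) → ContMDiff (𝓡 4) 𝓘(ℝ, ℝ) ∞ f → (∀ (x : M) (X Y : TangentSpace (𝓡 4) x), g.ricci x X Y + g.hessian f x X Y = (1 / 2 : ℝ) * g.val x X Y) → (∀ x : M, g.scalarCurvature x + g.gradSq f x = f x) → ∀ t : ℝ, 0 ≤ t → t * ((Literature.Geometry.Lorentzian.riemannianMeasure (g.toContMDiffRiemannianMetric hg)) {x | f x < t}).toReal - 3 * ∫ s in (0 : ℝ)..t, ((Literature.Geometry.Lorentzian.riemannianMeasure (g.toContMDiffRiemannianMetric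 hg)) {x | f x < s}).toReal = ∫ x in {x | f x < t}, (1 + f x - t) * g.scalarCurvature x ∂(Literature.Geometry.Lorentzian.riemannianMeasure (g.toContMDiffRiemannianMetric hg)) := by
  intro M _ _ _ _ _ _ _ _ _ g _ f hg hc hf hsol hnorm t ht
  obtain ⟨hR0, -, hprop⟩ :=
    NoncompactShrinkerGapCarrilloNiClauses.scalarCurvature_nonneg_and_isCompact_sublevel g f hg hc hf
      hsol hnorm
  haveI : LocallyCompactSpace M := Manifold.locallyCompact_of_finiteDimensional (M := M) (𝓡 4)
  haveI : IsFiniteMeasureOnCompacts (riemannianMeasure (g.toContMDiffRiemannianMetric hg)) := by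
    have h := isFiniteMeasureOnCompacts_riemVolume hg
    rwa [PseudoRiemannianMetric.riemVolume_eq hg] at h
  have hf0 : ∀ x, 0 ≤ f x := fun x ↦ by
    have h1 := hnorm x
    have h2 := g.gradSq_nonneg hg f x
    linarith [hR0 x]
  have hRc : Continuous fun x ↦ g.scalarCurvature x :=
    (PseudoRiemannianMetric.contMDiff_scalarCurvature g).continuous
  exact profile_identity (R := fun x ↦ g.scalarCurvature x) hf.continuous hRc hf0 hprop
    (fun s ↦ (helper_sublevelIdentity M g f hg hc hf hsol hnorm s).2) ht

/-- **The integral inequality of the volume profile** (registered helper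
`helper_volumeProfile_ineq` of line `Sketch`): on every complete connected normalised 4-d gradient
shrinking Ricci soliton and for every level `t`,
`(t − 2) · Vol{f<t} ≤ 3 ∫₀ᵗ Vol{f<s} ds` (the identity `helper_volumeProfileIdentity`, `R ≥ 0`,
and the flux inequality `∫_{f<t} R ≤ 2 Vol{f<t}`); equivalently `(∫₀ᵗ Vol{f<s} ds)/(t − 2)³` is
non-increasing on `(2, ∞)`. -/
theorem helper_volumeProfile_ineq : ∀ (M : Type) [TopologicalSpace M] [T2Space M] [SecondCountableTopology M] [ChartedSpace (EuclideanSpace ℝ (Fin 4)) M] [IsManifold (𝓡 4) ∞ M] [ConnectedSpace M] [T3Space M] [MeasurableSpace M] [BorelSpace M] (g : Literature.Geometry.Lorentzian.PseudoRiemannianMetric (𝓡 4) ∞ (EuclideanSpace ℝ (Fin 4)) (TangentSpace (𝓡 4) : M → Type _)) [g.HasLeviCivita] (f : M → ℝ) (hg : g.IsRiemannian), (∀ (x : M) (r : NNReal), IsCompact {y : M | g.edist hg x y ≤ r}) → ContMDiff (𝓡 4) 𝓘(ℝ, ℝ) ∞ f → (∀ (x : M) (X Y : TangentSpace (𝓡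 4) x), g.ricci x X Y + g.hessian f x X Y = (1 / 2 : ℝ) * g.val x X Y) → (∀ x : M, g.scalarCurvature x + g.gradSq f x = f x) → ∀ t : ℝ, (t - 2) * ((Literature.Geometry.Lorentzian.riemannianMeasure (g.toContMDiffRiemannianMetric hg)) {x | f x < t}).toReal ≤ 3 * ∫ s in (0 : ℝ)..t, ((Literature.Geometry.Lorentzian.riemannianMeasure (g.toContMDiffRiemannianMetric hg)) {x | f x < s}).toReal := by
  intro M _ _ _ _ _ _ _ _ _ g _ f hg hc hf hsol hnorm t
  obtain ⟨hR0, -, hprop⟩ :=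
    NoncompactShrinkerGapCarrilloNiClauses.scalarCurvature_nonneg_and_isCompact_sublevel g f hg hc hf
      hsol hnorm
  haveI : LocallyCompactSpace M := Manifold.locallyCompact_of_finiteDimensional (M := M) (𝓡 4)
  haveI : IsFiniteMeasureOnCompacts (riemannianMeasure (g.toContMDiffRiemannianMetric hg)) := by
    have h := isFiniteMeasureOnCompacts_riemVolume hg
    rwa [PseudoRiemannianMetric.riemVolume_eq hg] at h
  have hf0 : ∀ x, 0 ≤ f x := fun x ↦ by
    have h1 := hnorm x
    have h2 := g.gradSq_nonneg hg f x
    linarith [hR0 x]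
  have hRc : Continuous fun x ↦ g.scalarCurvature x :=
    (PseudoRiemannianMetric.contMDiff_scalarCurvature g).continuous
  exact profile_ineq (R := fun x ↦ g.scalarCurvature x) hf.continuous hRc hf0 hR0 hprop
    (fun s ↦ (helper_sublevelIdentity M g f hg hc hf hsol hnorm s).2)
    (helper_sublevelFlux_nonneg M g f hg hc hf hsol hnorm) t

/-- **Explicit volume growth** (registered helper `helper_volumeGrowth_explicit` of line `Sketch`;
Cao–Zhou 2010 Thm. 1.2 with explicit constants, sublevel form): on every complete connected
normalised 4-d gradient shrinking Ricci soliton, for `2 < s ≤ t`,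
`Vol{f<t} ≤ 3 (∫₀ˢ Vol{f<u} du) (t − 2)² / (s − 2)³`, and in particular
`Vol{f<t} ≤ 9 · Vol{f<3} · (t − 2)²` for every `t ≥ 3`. -/
theorem helper_volumeGrowth_explicit : ∀ (M : Type) [TopologicalSpace M] [T2Space M] [SecondCountableTopology M] [ChartedSpace (EuclideanSpace ℝ (Fin 4)) M] [IsManifold (𝓡 4) ∞ M] [ConnectedSpace M] [T3Space M] [MeasurableSpace M] [BorelSpace M] (g : Literature.Geometry.Lorentzian.PseudoRiemannianMetric (𝓡 4) ∞ (EuclideanSpace ℝ (Fin 4)) (TangentSpace (𝓡 4) : M → Type _)) [g.HasLeviCivita] (f : M → ℝ) (hg : g.IsRiemannian), (∀ (x : M) (r : NNReal), IsCompact {y : M | g.edist hg x y ≤ r}) → ContMDiff (𝓡 4) 𝓘(ℝ, ℝ) ∞ f → (∀ (x : M) (X Y : TangentSpace (𝓡 4) x), g.ricci x X Y + g.hessian f x X Y = (1 / 2 : ℝ) * g.val x X Y) → (∀ x : M, g.scalarCurvature x + g.gradSq f x = f x) → (∀ s t : ℝ, 2 < s → s ≤ t → ((Literature.Geometry.Lorentzian.riemannianMeasure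 (g.toContMDiffRiemannianMetric hg)) {x | f x < t}).toReal ≤ 3 * (∫ u in (0 : ℝ)..s, ((Literature.Geometry.Lorentzian.riemannianMeasure (g.toContMDiffRiemannianMetric hg)) {x | f x < u}).toReal) * (t - 2) ^ 2 / (s - 2) ^ 3) ∧ ∀ t : ℝ, 3 ≤ t → ((Literature.Geometry.Lorentzian.riemannianMeasure (g.toContMDiffRiemannianMetric hg)) {x | f x < t}).toReal ≤ 9 * ((Literature.Geometry.Lorentzian.riemannianMeasure (g.toContMDiffRiemannianMetric hg)) {x | f x < 3}).toReal * (t - 2) ^ 2 := by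
  intro M _ _ _ _ _ _ _ _ _ g _ f hg hc hf hsol hnorm
  obtain ⟨-, -, hprop⟩ :=
    NoncompactShrinkerGapCarrilloNiClauses.scalarCurvature_nonneg_and_isCompact_sublevel g f hg hc hf
      hsol hnorm
  haveI : LocallyCompactSpace M := Manifold.locallyCompact_of_finiteDimensional (M := M) (𝓡 4)
  haveI : IsFiniteMeasureOnCompacts (riemannianMeasure (g.toContMDiffRiemannianMetric hg)) := by
    have h := isFiniteMeasureOnCompacts_riemVolume hg
    rwa [PseudoRiemannianMetric.riemVolume_eq hg] at h
  set V : ℝ → ℝ := fun s ↦ ((riemannianMeasure (g.toContMDiffRiemannianMetric hg))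
    {x | f x < s}).toReal with hV
  have hVmono : Monotone V := profile_monotone hprop
  have hVnn : ∀ s, 0 ≤ V s := fun s ↦ ENNReal.toReal_nonneg
  have hineq : ∀ s : ℝ, (s - 2) * V s ≤ 3 * ∫ u in (0 : ℝ)..s, V u :=
    helper_volumeProfile_ineq M g f hg hc hf hsol hnorm
  obtain ⟨-, hgrowth⟩ := helper_sublevelGrowthMonotone V hVmono hVnn hineq
  refine ⟨fun s t hs hst ↦ hgrowth s t hs hst, fun t ht ↦ ?_⟩
  have h1 := hgrowth 3 t (by norm_num) ht
  rw [show ((3 : ℝ) - 2) ^ 3 = 1 by norm_num, div_one] at h1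
  have h2 : ∫ u in (0 : ℝ)..3, V u ≤ (3 - 0) * V 3 :=
    monotoneTauberian_integral_le_right hVmono (by norm_num)
  have h2' : ∫ u in (0 : ℝ)..3, V u ≤ 3 * V 3 := by linarith
  calc V t ≤ 3 * (∫ u in (0 : ℝ)..3, V u) * (t - 2) ^ 2 := h1
    _ ≤ 3 * (3 * V 3) * (t - 2) ^ 2 := by gcongr
    _ = 9 * V 3 * (t - 2) ^ 2 := by ring

/-- **Existence of the asymptotic volume ratio** (registered helper `helper_sublevelAvr_exists` of
line `Sketch`): on every complete connected normalised 4-d gradient shrinking Ricci soliton the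
sublevel asymptotic volume ratio `lim_{t→∞} Vol{f<t}/(8π²t²)` EXISTS (call it `A₀ ≥ 0`;
`Vol{|x|²/4 < t}/(8π²t²) = 1` on `ℝ⁴`), and it is fenced at every finite level by the core
volume profile: `8π² A₀ (t − 2)³ ≤ 3 ∫₀ᵗ Vol{f<s} ds` for all `t > 2` (monotone limit of
`(∫₀ᵗ Vol{f<s} ds)/(t − 2)³` + the monotone Tauberian step). -/
theorem helper_sublevelAvr_exists : ∀ (M : Type) [TopologicalSpace M] [T2Space M] [SecondCountableTopology M] [ChartedSpace (EuclideanSpace ℝ (Fin 4)) M] [IsManifold (𝓡 4) ∞ M] [ConnectedSpace M] [T3Space M] [MeasurableSpace M] [BorelSpace M] (g : Literature.Geometry.Lorentzian.PseudoRiemannianMetric (𝓡 4) ∞ (EuclideanSpace ℝ (Fin 4)) (TangentSpace (𝓡 4) : M → Type _)) [g.HasLeviCivita] (f : M → ℝ) (hg : g.IsRiemannian), (∀ (x : M) (r : NNReal), IsCompact {y : M | g.edist hg x y ≤ r}) → ContMDiff (𝓡 4) 𝓘(ℝ, ℝ) ∞ f → (∀ (x : M) (X Y : TangentSpace (𝓡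 4) x), g.ricci x X Y + g.hessian f x X Y = (1 / 2 : ℝ) * g.val x X Y) → (∀ x : M, g.scalarCurvature x + g.gradSq f x = f x) → ∃ A₀ : ℝ, 0 ≤ A₀ ∧ Filter.Tendsto (fun t : ℝ ↦ ((Literature.Geometry.Lorentzian.riemannianMeasure (g.toContMDiffRiemannianMetric hg)) {x | f x < t}).toReal / (8 * Real.pi ^ 2 * t ^ 2)) Filter.atTop (nhds A₀) ∧ ∀ t : ℝ, 2 < t → 8 * Real.pi ^ 2 * A₀ * (t - 2) ^ 3 ≤ 3 * ∫ s in (0 : ℝ)..t, ((Literature.Geometry.Lorentzian.riemannianMeasure (g.toContMDiffRiemannianMetric hg)) {x | f x < s}).toReal := by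
  intro M _ _ _ _ _ _ _ _ _ g _ f hg hc hf hsol hnorm
  obtain ⟨-, -, hprop⟩ :=
    NoncompactShrinkerGapCarrilloNiClauses.scalarCurvature_nonneg_and_isCompact_sublevel g f hg hc hf
      hsol hnorm
  haveI : LocallyCompactSpace M := Manifold.locallyCompact_of_finiteDimensional (M := M) (𝓡 4)
  haveI : IsFiniteMeasureOnCompacts (riemannianMeasure (g.toContMDiffRiemannianMetric hg)) := by
    have h := isFiniteMeasureOnCompacts_riemVolume hg
    rwa [PseudoRiemannianMetric.riemVolume_eq hg] at h
  set V : ℝ → ℝ := fun s ↦ ((riemannianMeasure (g.toContMDiffRiemannianMetric hg))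
    {x | f x < s}).toReal with hV
  have hVmono : Monotone V := profile_monotone hprop
  have hVnn : ∀ s, 0 ≤ V s := fun s ↦ ENNReal.toReal_nonneg
  have hineq : ∀ s : ℝ, (s - 2) * V s ≤ 3 * ∫ u in (0 : ℝ)..s, V u :=
    helper_volumeProfile_ineq M g f hg hc hf hsol hnorm
  obtain ⟨φ, hφ0, hlim, hfence⟩ := profile_avr_exists hVmono hVnn hineq
  have hπ : (0 : ℝ) < 8 * Real.pi ^ 2 := by positivity
  refine ⟨3 * φ / (8 * Real.pi ^ 2), div_nonneg (by linarith) hπ.le, ?_, fun t ht ↦ ?_⟩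
  · have h := hlim.div_const (8 * Real.pi ^ 2)
    refine h.congr' (Eventually.of_forall fun t ↦ ?_)
    show V t / t ^ 2 / (8 * Real.pi ^ 2) = V t / (8 * Real.pi ^ 2 * t ^ 2)
    rw [div_div, mul_comm (t ^ 2)]
  · have h := hfence t ht
    have hπ' : (8 * Real.pi ^ 2) ≠ 0 := hπ.ne'
    have e : 8 * Real.pi ^ 2 * (3 * φ / (8 * Real.pi ^ 2)) * (t - 2) ^ 3 = 3 * (φ * (t - 2) ^ 3) := by
      rw [mul_div_assoc', mul_comm (8 * Real.pi ^ 2) (3 * φ), mul_div_assoc, div_self hπ', mul_one]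
      ring
    rw [e]
    linarith

/-- **The regularised AVR is the sublevel AVR** (registered helper `helper_avr_eq_sublevelAvr` of
line `Sketch`): on every complete connected normalised 4-d gradient shrinking Ricci soliton, if
`(16π²T²)⁻¹ ∫ e^{-f/T} dV → a` (Wang–Wang's regularised asymptotic volume ratio, the `a` of the
line's density transform `∫ e^{-f} dV = 16π² a + ∫ R k(f) dV`), then `Vol{f<t}/(8π²t²) → a` as
`t → ∞` — the classical asymptotic volume ratio exists and equals `a`, with no conical-structure
hypothesis — and `8π² a (t − 2)³ ≤ 3 ∫₀ᵗ Vol{f<s} ds` for every `t > 2`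
(`helper_sublevelAvr_exists`, then `helper_avr_eq_sublevelLimit` and uniqueness of limits). -/
theorem helper_avr_eq_sublevelAvr : ∀ (M : Type) [TopologicalSpace M] [T2Space M] [SecondCountableTopology M] [ChartedSpace (EuclideanSpace ℝ (Fin 4)) M] [IsManifold (𝓡 4) ∞ M] [ConnectedSpace M] [T3Space M] [MeasurableSpace M] [BorelSpace M] (g : Literature.Geometry.Lorentzian.PseudoRiemannianMetric (𝓡 4) ∞ (EuclideanSpace ℝ (Fin 4)) (TangentSpace (𝓡 4) : M → Type _)) [g.HasLeviCivita] (f : M → ℝ) (hg : g.IsRiemannian), (∀ (x : M) (r : NNReal), IsCompact {y : M | g.edist hg x y ≤ r}) → ContMDiff (𝓡 4) 𝓘(ℝ, ℝ) ∞ f → (∀ (x : M) (X Y : TangentSpace (𝓡 4) x), g.ricci x X Y + g.hessian f x X Y = (1 / 2 : ℝ) * g.val x X Y) → (∀ x : M, g.scalarCurvature x + g.gradSq f x = f x) → ∀ a : ℝ, Filter.Tendsto (fun T : ℝ ↦ (16 * Real.pi ^ 2 * T ^ 2)⁻¹ * ∫ x, Real.exp (-f x / T) ∂(Literature.Geometry.Lorentzian.riemannianMeasure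 (g.toContMDiffRiemannianMetric hg))) Filter.atTop (nhds a) → Filter.Tendsto (fun t : ℝ ↦ ((Literature.Geometry.Lorentzian.riemannianMeasure (g.toContMDiffRiemannianMetric hg)) {x | f x < t}).toReal / (8 * Real.pi ^ 2 * t ^ 2)) Filter.atTop (nhds a) ∧ ∀ t : ℝ, 2 < t → 8 * Real.pi ^ 2 * a * (t - 2) ^ 3 ≤ 3 * ∫ s in (0 : ℝ)..t, ((Literature.Geometry.Lorentzian.riemannianMeasure (g.toContMDiffRiemannianMetric hg)) {x | f x < s}).toReal := by
  intro M _ _ _ _ _ _ _ _ _ g _ f hg hc hf hsol hnorm a ha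
  obtain ⟨hR0, -, -⟩ :=
    NoncompactShrinkerGapCarrilloNiClauses.scalarCurvature_nonneg_and_isCompact_sublevel g f hg hc hf
      hsol hnorm
  have hf0 : ∀ x, 0 ≤ f x := fun x ↦ by
    have h1 := hnorm x
    have h2 := g.gradSq_nonneg hg f x
    linarith [hR0 x]
  obtain ⟨A₀, -, hA₀, hfence⟩ := helper_sublevelAvr_exists M g f hg hc hf hsol hnorm
  have hint : ∀ T : ℝ, 0 < T → Integrable (fun x ↦ Real.exp (-f x / T))
      (riemannianMeasure (g.toContMDiffRiemannianMetric hg)) := fun T hT ↦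
    (stub_weightedIntegrability M g f hg hc hf hsol hnorm T hT).1
  have hreg := helper_avr_eq_sublevelLimit M (riemannianMeasure (g.toContMDiffRiemannianMetric hg))
    f hf.continuous.measurable hf0 hint A₀ hA₀
  have haA : a = A₀ := tendsto_nhds_unique ha hreg
  subst haA
  exact ⟨hA₀, hfence⟩

end Summit.SmoothPoincare4.SmoothPoincare4.Theorems.ConicalGapSketch

end
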